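import Mathlib.Analysis.SpecialFunctions.SmoothTransition
import Mathlib.Analysis.Calculus.IteratedDeriv.Lemmas
import Mathlib.Analysis.Calculus.Deriv.Support
import Mathlib.Analysis.Normed.Group.Bounded
import Mathlib.Algebra.BigOperators.Intervals
import HarnessLib

/-!
# The Gallavotti–Nicolò scale cutoffs `H₀`, `C_h⁻¹ = H₀(γ^{-h}·)`, `f_h = H₀(γ^{-h}·) - H₀(γ^{-h+1}·)`
(Benfatto–Giuliani–Mastropietro 2006, (2.9), (2.19), (2.28))

Topic `Literature/MathematicalPhysics/QuantumLattice` (multiscale infrastructure of the fermionic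
renormalisation group).

BGM 2006, (2.9): "a smooth support function `H₀(t)`, `t ∈ ℝ`, such that `H₀(t) = 1` if
`t < e₀/γ`, `= 0` if `t > e₀`, with `γ = 4` and `e₀` a parameter"; (2.19): the infrared cutoff at
scale `h ≤ 0` is `C_h⁻¹(k) = H₀[γ^{-h}|-ik₀ + E_h(k) - μ|]`; (2.28): the single-scale cutoff is
`f_h(k) = H₀[γ^{-h}|…|] - H₀[γ^{-h+1}|…|]` (the same construction, with a fixed dispersion
relation, is (2.29)–(2.31) of Mastropietro, *Non-perturbative renormalization*, §2.3, and (2.2) of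
BGM 2003). This file fixes ONE explicit such `H₀` (from Mathlib's `Real.smoothTransition`) and
PROVES, for the resulting one-variable functions of `t = |-ik₀ + E(k) - μ|`:

* `gnCutoff γ e₀` (`H₀`): smooth, `[0,1]`-valued, ANTITONE, `= 1` on `t ≤ e₀/γ`, `= 0` on `t ≥ e₀`;
* `gnScaleCutoff γ e₀ h t = H₀(γ^{-h} t)` (`C_h⁻¹`) and `gnShell γ e₀ h t = C_h⁻¹(t) - C_{h-1}⁻¹(t)`
  (`f_h`), `h ∈ ℤ`: smooth, `[0,1]`-valued (`gnShell_nonneg` uses antitonicity), with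
  **support** `f_h(t) ≠ 0 ⟹ e₀γ^{h-2} < t < e₀γ^h` (`gnShell_eq_zero_of_le`, `_of_ge`) — the
  momenta of scale `h` have `|-ik₀ + E - μ| ≍ γ^h`;
* the **telescoping identity** `H₀(t) = C_{h'}⁻¹(t) + Σ_{h'<h≤0} f_h(t)` (`gnCutoff_eq_sum_shells`,
  the decomposition `ψ^{(≤0)} = ψ^{(≤h')} + Σ ψ^{(h)}` of (2.17)–(2.29) at the level of cutoffs);
* the **dimensional derivative bounds** `|∂_t^m C_h⁻¹(t)| ≤ C_m γ^{-hm}` and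
  `|∂_t^m f_h(t)| ≤ C_m (1 + γ^m) γ^{-hm}` (`abs_iteratedDeriv_gnScaleCutoff_le`,
  `abs_iteratedDeriv_gnShell_le`), by scaling from the bounded derivatives of `H₀`.

Everything is PROVED; the three definitions have bodies. The dispersion-dependent version of
(2.28) (with `E_h` changing from scale to scale) is the composition of these one-variable functions
with `|-ik₀ + E_h(k) - μ|` and is not restated here (`-- TODO(general form)` below).

## Sources

* G. Benfatto, A. Giuliani, V. Mastropietro, Ann. Henri Poincaré 7 (2006) 809–898, (2.9), (2.19),
  (2.28) (arXiv:cond-mat/0507686 pp. 6–7). [BenfattoGiulianiMastropietro2006]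
* V. Mastropietro, *Non-Perturbative Renormalization*, World Scientific (2008), §2.3. [Mastropietro2008]
-/

noncomputable section

open Real Set Filter
open scoped Topology

namespace Literature.MathematicalPhysics.QuantumLattice

-- TODO(general form): BGM (2.28) composes `H₀(γ^{-h}·)` with the scale-dependent `|-ik₀ + E_h(k) - μ|`;
-- here the one-variable functions only.

variable {γ e₀ : ℝ}

/-! ### `H₀` -/

/-- **The smooth support function `H₀`** of BGM (2.9): `H₀(t) = S((e₀ - t)/(e₀(1 - γ⁻¹)))` with `S`
Mathlib's `Real.smoothTransition` — smooth, antitone, `1` for `t ≤ e₀/γ`, `0` for `t ≥ e₀`. [cite: BenfattoGiulianiMastropietro2006, §2.2 (2.9)] -/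
def gnCutoff (γ e₀ : ℝ) (t : ℝ) : ℝ := Real.smoothTransition ((e₀ - t) / (e₀ * (1 - γ⁻¹)))

/-- `H₀` is smooth. [folklore] -/
theorem contDiff_gnCutoff (γ e₀ : ℝ) {m : ℕ∞} : ContDiff ℝ m (gnCutoff γ e₀) :=
  Real.smoothTransition.contDiff.comp ((contDiff_const.sub contDiff_id).div_const _)

/-- `0 ≤ H₀ ≤ 1`. [folklore] -/
theorem gnCutoff_mem_Icc (γ e₀ t : ℝ) : gnCutoff γ e₀ t ∈ Icc (0 : ℝ) 1 :=
  ⟨Real.smoothTransition.nonneg _, Real.smoothTransition.le_one _⟩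

/-- The normalising denominator is positive for `γ > 1`, `e₀ > 0`. [folklore] -/
theorem gnCutoff_denom_pos (hγ : 1 < γ) (he : 0 < e₀) : 0 < e₀ * (1 - γ⁻¹) :=
  mul_pos he (by rw [sub_pos]; exact inv_lt_one_of_one_lt₀ hγ)

/-- `H₀` is antitone. [cite: BenfattoGiulianiMastropietro2006, §2.2 (2.9)] -/
theorem antitone_gnCutoff (hγ : 1 < γ) (he : 0 < e₀) : Antitone (gnCutoff γ e₀) := fun s t hst =>
  Real.smoothTransition.monotone
    (div_le_div_of_nonneg_right (by linarith) (gnCutoff_denom_pos hγ he).le)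

/-- `H₀(t) = 1` for `t ≤ e₀/γ`. [cite: BenfattoGiulianiMastropietro2006, §2.2 (2.9)] -/
theorem gnCutoff_eq_one (hγ : 1 < γ) (he : 0 < e₀) {t : ℝ} (ht : t ≤ e₀ / γ) : gnCutoff γ e₀ t = 1 := by
  apply Real.smoothTransition.one_of_one_le
  rw [le_div_iff₀ (gnCutoff_denom_pos hγ he), one_mul, mul_sub, mul_one, ← div_eq_mul_inv]
  linarith

/-- `H₀(t) = 0` for `t ≥ e₀`. [cite: BenfattoGiulianiMastropietro2006, §2.2 (2.9)] -/
theorem gnCutoff_eq_zero (hγ : 1 < γ) (he : 0 < e₀) {t : ℝ} (ht : e₀ ≤ t) : gnCutoff γ e₀ t = 0 :=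
  Real.smoothTransition.zero_of_nonpos (div_nonpos_of_nonpos_of_nonneg (by linarith) (gnCutoff_denom_pos hγ he).le)

/-- `H₀` minus the indicator of `(-∞, e₀/γ]`… more usefully: `H₀ - 1` has compact support in
`[e₀/γ, e₀]` after restricting to `t ≥ 0`; what the derivative bounds need is that every derivative
of `H₀` of positive order has compact support. [folklore] -/
theorem iteratedDeriv_gnCutoff_eq_zero (hγ : 1 < γ) (he : 0 < e₀) {m : ℕ} (hm : m ≠ 0) {t : ℝ}
    (ht : t < e₀ / γ ∨ e₀ < t) : iteratedDeriv m (gnCutoff γ e₀) t = 0 := by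
  rcases ht with ht | ht
  · -- locally constant `= 1`
    have hev : gnCutoff γ e₀ =ᶠ[𝓝 t] fun _ => (1 : ℝ) := by
      filter_upwards [Iio_mem_nhds ht] with s hs using gnCutoff_eq_one hγ he hs.le
    rw [(hev.iteratedDeriv m).eq_of_nhds, iteratedDeriv_const]
    simp [hm]
  · have hev : gnCutoff γ e₀ =ᶠ[𝓝 t] fun _ => (0 : ℝ) := by
      filter_upwards [Ioi_mem_nhds ht] with s hs using gnCutoff_eq_zero hγ he hs.le
    rw [(hev.iteratedDeriv m).eq_of_nhds, iteratedDeriv_const]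
    simp [hm]

/-- **Every derivative of `H₀` is bounded.** [folklore] -/
theorem exists_bound_iteratedDeriv_gnCutoff (hγ : 1 < γ) (he : 0 < e₀) (m : ℕ) :
    ∃ C : ℝ, 0 ≤ C ∧ ∀ t : ℝ, |iteratedDeriv m (gnCutoff γ e₀) t| ≤ C := by
  have hcont : Continuous (iteratedDeriv m (gnCutoff γ e₀)) :=
    (contDiff_gnCutoff γ e₀ (m := ⊤)).continuous_iteratedDeriv m (by exact_mod_cast le_top)
  -- bounded on the compact interval `[e₀/γ, e₀]`, and `0`/`≤ 1` outside
  obtain ⟨C, hC⟩ := (isCompact_Icc (a := e₀ / γ) (b := e₀)).exists_bound_of_continuousOn hcont.continuousOn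
  refine ⟨max C 1, le_max_of_le_right zero_le_one, fun t => ?_⟩
  by_cases ht : t ∈ Icc (e₀ / γ) e₀
  · exact ((Real.norm_eq_abs _).symm.le.trans (hC t ht)).trans (le_max_left _ _)
  · rw [mem_Icc, not_and_or, not_le, not_le] at ht
    rcases Nat.eq_zero_or_pos m with hm | hm
    · subst hm
      rw [iteratedDeriv_zero]
      have h := gnCutoff_mem_Icc γ e₀ t
      rw [abs_of_nonneg h.1]
      exact h.2.trans (le_max_right _ _)
    · rw [iteratedDeriv_gnCutoff_eq_zero hγ he hm.ne' ht, abs_zero]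
      exact le_trans zero_le_one (le_max_right _ _)

/-! ### `C_h⁻¹` and `f_h` -/

/-- **The infrared cutoff at scale `h`**: `C_h⁻¹(t) = H₀(γ^{-h} t)` (BGM (2.19)). [cite: BenfattoGiulianiMastropietro2006, §2.3 (2.19)] -/
def gnScaleCutoff (γ e₀ : ℝ) (h : ℤ) (t : ℝ) : ℝ := gnCutoff γ e₀ (γ ^ (-h) * t)

/-- **The single-scale cutoff** `f_h(t) = H₀(γ^{-h} t) - H₀(γ^{-h+1} t) = C_h⁻¹(t) - C_{h-1}⁻¹(t)`
(BGM (2.28) with a fixed dispersion relation). [cite: BenfattoGiulianiMastropietro2006, §2.3 (2.28)] -/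
def gnShell (γ e₀ : ℝ) (h : ℤ) (t : ℝ) : ℝ := gnScaleCutoff γ e₀ h t - gnScaleCutoff γ e₀ (h - 1) t

/-- `C_{h-1}⁻¹(t) = H₀(γ^{-h+1} t)`. [folklore] -/
theorem gnScaleCutoff_sub_one (γ e₀ : ℝ) (h : ℤ) (t : ℝ) :
    gnScaleCutoff γ e₀ (h - 1) t = gnCutoff γ e₀ (γ ^ (-h + 1) * t) := by
  rw [gnScaleCutoff, neg_sub, sub_eq_neg_add]

/-- `C_h⁻¹` is smooth in `t`. [folklore] -/
theorem contDiff_gnScaleCutoff (γ e₀ : ℝ) (h : ℤ) {m : ℕ∞} : ContDiff ℝ m (gnScaleCutoff γ e₀ h) :=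
  (contDiff_gnCutoff γ e₀).comp (contDiff_const.mul contDiff_id)

/-- `f_h` is smooth in `t`. [folklore] -/
theorem contDiff_gnShell (γ e₀ : ℝ) (h : ℤ) {m : ℕ∞} : ContDiff ℝ m (gnShell γ e₀ h) :=
  (contDiff_gnScaleCutoff γ e₀ h).sub (contDiff_gnScaleCutoff γ e₀ (h - 1))

/-- `0 ≤ C_h⁻¹ ≤ 1`. [folklore] -/
theorem gnScaleCutoff_mem_Icc (γ e₀ : ℝ) (h : ℤ) (t : ℝ) : gnScaleCutoff γ e₀ h t ∈ Icc (0 : ℝ) 1 :=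
  gnCutoff_mem_Icc _ _ _

/-- `C_h⁻¹(t) = 1` for `t ≤ e₀ γ^{h-1}`. [cite: BenfattoGiulianiMastropietro2006, §2.3 (2.19)] -/
theorem gnScaleCutoff_eq_one (hγ : 1 < γ) (he : 0 < e₀) {h : ℤ} {t : ℝ} (ht : t ≤ e₀ * γ ^ (h - 1)) :
    gnScaleCutoff γ e₀ h t = 1 := by
  have hγ0 : 0 < γ := by linarith
  apply gnCutoff_eq_one hγ he
  rw [le_div_iff₀ hγ0]
  calc γ ^ (-h) * t * γ ≤ γ ^ (-h) * (e₀ * γ ^ (h - 1)) * γ :=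
        mul_le_mul_of_nonneg_right (mul_le_mul_of_nonneg_left ht (zpow_pos hγ0 _).le) hγ0.le
    _ = e₀ := by
        rw [zpow_sub_one₀ hγ0.ne', zpow_neg]
        field_simp

/-- `C_h⁻¹(t) = 0` for `t ≥ e₀ γ^h`. [cite: BenfattoGiulianiMastropietro2006, §2.3 (2.19)] -/
theorem gnScaleCutoff_eq_zero (hγ : 1 < γ) (he : 0 < e₀) {h : ℤ} {t : ℝ} (ht : e₀ * γ ^ h ≤ t) :
    gnScaleCutoff γ e₀ h t = 0 := by
  have hγ0 : 0 < γ := by linarith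
  apply gnCutoff_eq_zero hγ he
  calc e₀ = γ ^ (-h) * (e₀ * γ ^ h) := by rw [zpow_neg]; field_simp
    _ ≤ γ ^ (-h) * t := mul_le_mul_of_nonneg_left ht (zpow_pos hγ0 _).le

/-- **`f_h ≥ 0`** (antitonicity of `H₀`; for `t ≥ 0`, `γ^{-h}t ≤ γ^{-h+1}t`). [cite: BenfattoGiulianiMastropietro2006, §2.3 (2.28)] -/
theorem gnShell_nonneg (hγ : 1 < γ) (he : 0 < e₀) (h : ℤ) {t : ℝ} (ht : 0 ≤ t) : 0 ≤ gnShell γ e₀ h t := by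
  have hγ0 : 0 < γ := by linarith
  rw [gnShell, gnScaleCutoff_sub_one, gnScaleCutoff, sub_nonneg]
  apply antitone_gnCutoff hγ he
  rw [zpow_add_one₀ hγ0.ne']
  calc γ ^ (-h) * t = γ ^ (-h) * 1 * t := by rw [mul_one]
    _ ≤ γ ^ (-h) * γ * t := by gcongr

/-- `f_h ≤ 1`. [folklore] -/
theorem gnShell_le_one (γ e₀ : ℝ) (h : ℤ) (t : ℝ) : gnShell γ e₀ h t ≤ 1 := by
  rw [gnShell]
  linarith [(gnScaleCutoff_mem_Icc γ e₀ h t).2, (gnScaleCutoff_mem_Icc γ e₀ (h - 1) t).1]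

/-- **Support of `f_h`, lower end**: `f_h(t) = 0` for `t ≤ e₀ γ^{h-2}` (both cutoffs equal `1`). [cite: BenfattoGiulianiMastropietro2006, §2.3 (2.28)] -/
theorem gnShell_eq_zero_of_le (hγ : 1 < γ) (he : 0 < e₀) {h : ℤ} {t : ℝ} (ht : t ≤ e₀ * γ ^ (h - 2)) :
    gnShell γ e₀ h t = 0 := by
  have hγ0 : 0 < γ := by linarith
  have h1 : t ≤ e₀ * γ ^ (h - 1) :=
    ht.trans (mul_le_mul_of_nonneg_left ((zpow_le_zpow_iff_right₀ hγ).2 (by linarith)) he.le)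
  rw [gnShell, gnScaleCutoff_eq_one hγ he h1, gnScaleCutoff_eq_one hγ he (by rwa [sub_sub, one_add_one_eq_two]),
    sub_self]

/-- **Support of `f_h`, upper end**: `f_h(t) = 0` for `t ≥ e₀ γ^h` (both cutoffs vanish). [cite: BenfattoGiulianiMastropietro2006, §2.3 (2.28)] -/
theorem gnShell_eq_zero_of_ge (hγ : 1 < γ) (he : 0 < e₀) {h : ℤ} {t : ℝ} (ht : e₀ * γ ^ h ≤ t) :
    gnShell γ e₀ h t = 0 := by
  have hγ0 : 0 < γ := by linarith
  have h1 : e₀ * γ ^ (h - 1) ≤ t :=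
    le_trans (mul_le_mul_of_nonneg_left ((zpow_le_zpow_iff_right₀ hγ).2 (by linarith)) he.le) ht
  rw [gnShell, gnScaleCutoff_eq_zero hγ he ht, gnScaleCutoff_eq_zero hγ he h1, sub_self]

/-- The momenta of scale `h`: `f_h(t) ≠ 0 ⟹ e₀γ^{h-2} < t < e₀γ^h`. [cite: BenfattoGiulianiMastropietro2006, §2.3 (2.28)] -/
theorem mem_Ioo_of_gnShell_ne_zero (hγ : 1 < γ) (he : 0 < e₀) {h : ℤ} {t : ℝ} (ht : gnShell γ e₀ h t ≠ 0) :
    t ∈ Ioo (e₀ * γ ^ (h - 2)) (e₀ * γ ^ h) := by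
  constructor
  · by_contra hc
    exact ht (gnShell_eq_zero_of_le hγ he (not_lt.1 hc))
  · by_contra hc
    exact ht (gnShell_eq_zero_of_ge hγ he (not_lt.1 hc))

/-- **Telescoping**: `C_0⁻¹(t) = C_{-n}⁻¹(t) + Σ_{j<n} f_{-j}(t)`, i.e. `H₀ = C_{h'}⁻¹ + Σ_{h'<h≤0} f_h`
with `h' = -n`. [cite: BenfattoGiulianiMastropietro2006, §2.3 (2.17)–(2.29)] -/
theorem gnCutoff_eq_sum_shells (γ e₀ : ℝ) (n : ℕ) (t : ℝ) :
    gnCutoff γ e₀ t = gnScaleCutoff γ e₀ (-(n : ℤ)) t + ∑ j ∈ Finset.range n, gnShell γ e₀ (-(j : ℤ)) t := by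
  induction n with
  | zero => simp [gnScaleCutoff]
  | succ n ih =>
    rw [Finset.sum_range_succ, ih, gnShell]
    push_cast
    ring_nf

/-! ### Dimensional derivative bounds -/

/-- Derivatives of `C_h⁻¹`: `∂_t^m C_h⁻¹(t) = γ^{-hm} H₀^{(m)}(γ^{-h}t)`. [folklore] -/
theorem iteratedDeriv_gnScaleCutoff (γ e₀ : ℝ) (h : ℤ) (m : ℕ) (t : ℝ) :
    iteratedDeriv m (gnScaleCutoff γ e₀ h) t = (γ ^ (-h)) ^ m * iteratedDeriv m (gnCutoff γ e₀) (γ ^ (-h) * t) := by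
  have := congrFun (iteratedDeriv_comp_const_mul (contDiff_gnCutoff γ e₀ (m := m)) (γ ^ (-h))) t
  exact this

/-- **`|∂_t^m C_h⁻¹| ≤ C_m γ^{-hm}`.** [cite: BenfattoGiulianiMastropietro2006, §2.3 (2.19)] -/
theorem abs_iteratedDeriv_gnScaleCutoff_le (hγ : 1 < γ) (he : 0 < e₀) (m : ℕ) :
    ∃ C : ℝ, 0 ≤ C ∧ ∀ (h : ℤ) (t : ℝ), |iteratedDeriv m (gnScaleCutoff γ e₀ h) t| ≤ C * (γ ^ (-h)) ^ m := by
  have hγ0 : 0 < γ := by linarith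
  obtain ⟨C, hC0, hC⟩ := exists_bound_iteratedDeriv_gnCutoff hγ he m
  refine ⟨C, hC0, fun h t => ?_⟩
  rw [iteratedDeriv_gnScaleCutoff, abs_mul, abs_of_pos (pow_pos (zpow_pos hγ0 _) _), mul_comm]
  exact mul_le_mul_of_nonneg_right (hC _) (pow_pos (zpow_pos hγ0 _) _).le

/-- **`|∂_t^m f_h| ≤ C_m (1 + γ^m) γ^{-hm}`** (the single-scale cutoff costs `γ^{-h}` per derivative). [cite: BenfattoGiulianiMastropietro2006, §2.3 (2.28)] -/
theorem abs_iteratedDeriv_gnShell_le (hγ : 1 < γ) (he : 0 < e₀) (m : ℕ) :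
    ∃ C : ℝ, 0 ≤ C ∧ ∀ (h : ℤ) (t : ℝ), |iteratedDeriv m (gnShell γ e₀ h) t| ≤ C * (1 + γ ^ m) * (γ ^ (-h)) ^ m := by
  have hγ0 : 0 < γ := by linarith
  obtain ⟨C, hC0, hC⟩ := abs_iteratedDeriv_gnScaleCutoff_le hγ he m
  refine ⟨C, hC0, fun h t => ?_⟩
  have hsub : iteratedDeriv m (gnShell γ e₀ h) t =
      iteratedDeriv m (gnScaleCutoff γ e₀ h) t - iteratedDeriv m (gnScaleCutoff γ e₀ (h - 1)) t := by
    have : gnShell γ e₀ h = gnScaleCutoff γ e₀ h - gnScaleCutoff γ e₀ (h - 1) := rfl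
    rw [this, iteratedDeriv_sub ((contDiff_gnScaleCutoff γ e₀ h).contDiffAt)
      ((contDiff_gnScaleCutoff γ e₀ (h - 1)).contDiffAt)]
  have h1 := hC h t
  have h2 := hC (h - 1) t
  have hpow : (γ ^ (-(h - 1))) ^ m = γ ^ m * (γ ^ (-h)) ^ m := by
    rw [neg_sub, sub_eq_neg_add, zpow_add_one₀ hγ0.ne', mul_pow, mul_comm]
  rw [hpow] at h2
  rw [hsub]
  calc _ ≤ |iteratedDeriv m (gnScaleCutoff γ e₀ h) t| + |iteratedDeriv m (gnScaleCutoff γ e₀ (h - 1)) t| := abs_sub _ _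
    _ ≤ C * (γ ^ (-h)) ^ m + C * (γ ^ m * (γ ^ (-h)) ^ m) := add_le_add h1 h2
    _ = C * (1 + γ ^ m) * (γ ^ (-h)) ^ m := by ring

end Literature.MathematicalPhysics.QuantumLattice

end
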